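import Mathlib
import HarnessLib
import Literature.Computability.AlgebraicComplexity.PatternExpressions
import Summits.ValiantsHypothesis.ValiantsHypothesis.Theorems.MonotoneRestorationMonotoneRestorationQPLinearWidthDefs
import Summits.ValiantsHypothesis.ValiantsHypothesis.Theorems.MonotoneRestorationMonotoneRestorationQPLinearWidthHomIndistShift
import Summits.ValiantsHypothesis.ValiantsHypothesis.Theorems.MonotoneRestorationMonotoneRestorationQPLinearWidthDirectSumCongruence

/-!
# Route MonotoneRestoration, crux `MonotoneRestorationQP` (stmt-15886), line `linear_width` —
# CONNECTED PATTERNS ARE ADDITIVE ON WEIGHTED DIRECT SUMS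

Helper file (`--supports stmt-ValiantsHypothesis-15886`), def-free.

Companion of `…LinearWidthDirectSumCongruence.lean` (`DirectSumCongruence.homIndist_directSum`, the direct-sum
congruence for weighted `HomIndist`).  The other classical fact about disjoint unions used by the isolation arguments
of Dawar–Pago–Seppelt 2025 §7 is ADDITIVITY: a CONNECTED pattern maps into a disjoint union by mapping into one side.
In the tree's weighted currency (points of `ℂ^{n×n}` = edge-weighted bipartite hosts, block-diagonal points = weighted
disjoint unions):

* `col_eq_of_preconnected` — if the pattern graph of `F` is preconnected and a 2-colouring of its vertices is constant
  along every edge of `F`, it is constant;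
* `prod_add_eq_of_preconnected` — for `Z` supported on the block `κ = false` and `Y` on the block `κ = true` of a
  2-colouring `κ` of the indices and a label assignment `h` of a preconnected nonempty pattern `F`:
  `Π_{e ∈ F} (Z + Y)(h e) = Π_{e ∈ F} Z(h e) + Π_{e ∈ F} Y(h e)` (either `h` crosses the blocks along some edge, and all
  three products vanish, or `h` maps every vertex into one block, and the other block's product vanishes);
* `eval_homPoly_add_of_preconnected` — hence `hom_F(Z + Y) = hom_F(Z) + hom_F(Y)` at one level;
* `eval_homPoly_directSum_of_connected` — **ADDITIVITY**: for a connected isolated-vertex-free pattern `F` and all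
  `z ∈ ℂ^{ν×ν}`, `y ∈ ℂ^{m×m}`: `hom_{F,ν+m}(z ⊕ y) = hom_{F,ν}(z) + hom_{F,m}(y)` (blocks = `Matrix.fromBlocks z 0 0 y`
  read through `finSumFinEquiv`; the two summands are read one level down by
  `DirectSumCongruence.eval_homPoly_zeroExtend`);
* `fromBlocks_diag_eq_add`, `fromBlocks_inl_ne_zero`, `fromBlocks_inr_ne_zero`, `fromBlocks_inl_read`,
  `fromBlocks_inr_read` — the block bookkeeping, stated once for reuse.

Honest label: infrastructure (the additive half of "hom is additive on connected patterns and multiplicative on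
products" in weighted currency); for CONNECTED expansions the direct-sum isolation therefore yields only level-downward
monotonicity (`…LinearWidthLevelDownward.lean`); the component-wise isolation of DISCONNECTED patterns (DPS25 §7.1.1)
would need in addition the decomposition of a pattern into the disjoint union of its components, not in the tree.
No stub closed; the rung, the cruxes and VP ≠ VNP are NOT moved.
[cite: DawarPagoSeppelt2025, §7.1.1; Lovasz2012, eq. (5.28); DwivediPagoSeppelt2026, eq. (1)]
-/

set_option linter.dupNamespace false

noncomputable section

open scoped Classical

namespace Summit.ValiantsHypothesis.ValiantsHypothesis.Theorems.DirectSumAdditive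

open MvPolynomial Finset
open Literature.Computability.AlgebraicComplexity
open Summit.ValiantsHypothesis.ValiantsHypothesis.Theorems.MonotoneRestorationQPLinearWidth
open Summit.ValiantsHypothesis.ValiantsHypothesis.Theorems.DirectSumCongruence

variable {n : ℕ}

/-! ### Connected patterns do not cross blocks -/

/-- On a preconnected pattern graph, a 2-colouring of the vertices that is constant along every edge of the pattern
is constant. [folklore] -/
theorem col_eq_of_preconnected {a b : ℕ} (F : Multiset (Fin a × Fin b)) (hconn : (patternGraph F).Preconnected)
    (col : Fin a ⊕ Fin b → Bool) (hedge : ∀ e ∈ F, col (Sum.inl e.1) = col (Sum.inr e.2))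
    (x y : Fin a ⊕ Fin b) : col x = col y := by
  have hxy := hconn x y
  rw [SimpleGraph.reachable_iff_reflTransGen] at hxy
  have key : ∀ w, Relation.ReflTransGen (patternGraph F).Adj x w → col x = col w := by
    intro w hw
    induction hw with
    | refl => rfl
    | tail _ hadj ih =>
      rw [ih]
      rw [patternGraph, SimpleGraph.fromRel_adj] at hadj
      rcases hadj.2 with ⟨p, hp, h1, h2⟩ | ⟨p, hp, h1, h2⟩
      · rw [h1, h2]; exact hedge p hp
      · rw [h1, h2]; exact (hedge p hp).symm
  exact key y hxy

/-- **Per-assignment additivity.**  Let `κ` 2-colour the indices `Fin n`, `Z` be supported on the block `κ = false`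
and `Y` on the block `κ = true`, and let `F` be a nonempty pattern with preconnected pattern graph.  For every label
assignment `h`, `Π_{e ∈ F} (Z + Y)(h e) = Π_{e ∈ F} Z(h e) + Π_{e ∈ F} Y(h e)`. [folklore] -/
theorem prod_add_eq_of_preconnected {a b : ℕ} (κ : Fin n → Bool) {Z Y : Fin n × Fin n → ℂ}
    (hZ : ∀ p q, Z (p, q) ≠ 0 → κ p = false ∧ κ q = false)
    (hY : ∀ p q, Y (p, q) ≠ 0 → κ p = true ∧ κ q = true)
    (F : Multiset (Fin a × Fin b)) (hconn : (patternGraph F).Preconnected) (hF : F ≠ 0)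
    (h : (Fin a → Fin n) × (Fin b → Fin n)) :
    (F.map fun e => (Z + Y) (h.1 e.1, h.2 e.2)).prod =
      (F.map fun e => Z (h.1 e.1, h.2 e.2)).prod + (F.map fun e => Y (h.1 e.1, h.2 e.2)).prod := by
  by_cases hcross : ∃ e ∈ F, κ (h.1 e.1) ≠ κ (h.2 e.2)
  · -- an edge crosses the blocks: all three products vanish
    obtain ⟨e, he, hne⟩ := hcross
    have hZe : Z (h.1 e.1, h.2 e.2) = 0 := by
      by_contra h0
      obtain ⟨h1, h2⟩ := hZ _ _ h0
      exact hne (h1.trans h2.symm)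
    have hYe : Y (h.1 e.1, h.2 e.2) = 0 := by
      by_contra h0
      obtain ⟨h1, h2⟩ := hY _ _ h0
      exact hne (h1.trans h2.symm)
    have p1 : (F.map fun e => (Z + Y) (h.1 e.1, h.2 e.2)).prod = 0 :=
      Multiset.prod_eq_zero (Multiset.mem_map.2 ⟨e, he, by rw [Pi.add_apply, hZe, hYe, add_zero]⟩)
    have p2 : (F.map fun e => Z (h.1 e.1, h.2 e.2)).prod = 0 :=
      Multiset.prod_eq_zero (Multiset.mem_map.2 ⟨e, he, hZe⟩)
    have p3 : (F.map fun e => Y (h.1 e.1, h.2 e.2)).prod = 0 :=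
      Multiset.prod_eq_zero (Multiset.mem_map.2 ⟨e, he, hYe⟩)
    rw [p1, p2, p3, add_zero]
  · -- no edge crosses: every vertex is mapped into one and the same block
    push Not at hcross
    have hconst := col_eq_of_preconnected F hconn (Sum.elim (fun i => κ (h.1 i)) (fun j => κ (h.2 j)))
      (fun e he => hcross e he)
    obtain ⟨e₀, he₀⟩ := Multiset.exists_mem_of_ne_zero hF
    have hrow : ∀ e ∈ F, κ (h.1 e.1) = κ (h.1 e₀.1) := fun e _ => hconst (Sum.inl e.1) (Sum.inl e₀.1)
    have hcol : ∀ e ∈ F, κ (h.2 e.2) = κ (h.1 e₀.1) := fun e _ => hconst (Sum.inr e.2) (Sum.inl e₀.1)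
    cases hc : κ (h.1 e₀.1)
    · -- everything in the `false` block: the `Y`-product vanishes
      have hYe : ∀ e ∈ F, Y (h.1 e.1, h.2 e.2) = 0 := fun e he => by
        by_contra h0
        have := (hY _ _ h0).1
        rw [hrow e he, hc] at this
        exact Bool.false_ne_true this
      have p3 : (F.map fun e => Y (h.1 e.1, h.2 e.2)).prod = 0 :=
        Multiset.prod_eq_zero (Multiset.mem_map.2 ⟨e₀, he₀, hYe e₀ he₀⟩)
      rw [p3, add_zero]
      exact congrArg Multiset.prod (Multiset.map_congr rfl fun e he => by rw [Pi.add_apply, hYe e he, add_zero])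
    · -- everything in the `true` block: the `Z`-product vanishes
      have hZe : ∀ e ∈ F, Z (h.1 e.1, h.2 e.2) = 0 := fun e he => by
        by_contra h0
        have := (hZ _ _ h0).1
        rw [hrow e he, hc] at this
        exact Bool.false_ne_true this.symm
      have p2 : (F.map fun e => Z (h.1 e.1, h.2 e.2)).prod = 0 :=
        Multiset.prod_eq_zero (Multiset.mem_map.2 ⟨e₀, he₀, hZe e₀ he₀⟩)
      rw [p2, zero_add]
      exact congrArg Multiset.prod (Multiset.map_congr rfl fun e he => by rw [Pi.add_apply, hZe e he, zero_add])

/-- **One-level additivity**: `hom_F(Z + Y) = hom_F(Z) + hom_F(Y)` for `Z, Y` supported on the two blocks of a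
2-colouring of the indices and `F` nonempty with preconnected pattern graph. [cite: Lovasz2012, eq. (5.28)] -/
theorem eval_homPoly_add_of_preconnected {a b : ℕ} (κ : Fin n → Bool) {Z Y : Fin n × Fin n → ℂ}
    (hZ : ∀ p q, Z (p, q) ≠ 0 → κ p = false ∧ κ q = false)
    (hY : ∀ p q, Y (p, q) ≠ 0 → κ p = true ∧ κ q = true)
    (F : Multiset (Fin a × Fin b)) (hconn : (patternGraph F).Preconnected) (hF : F ≠ 0) :
    eval (Z + Y) (homPoly F n ℂ) = eval Z (homPoly F n ℂ) + eval Y (homPoly F n ℂ) := by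
  rw [HomIndistShift.eval_homPoly, HomIndistShift.eval_homPoly, HomIndistShift.eval_homPoly,
    ← Finset.sum_add_distrib]
  exact Finset.sum_congr rfl fun h _ => prod_add_eq_of_preconnected κ hZ hY F hconn hF h

/-! ### Block bookkeeping for `Matrix.fromBlocks z 0 0 y` -/

/-- The block-diagonal point `z ⊕ y` is the sum of its two zero-extended blocks. [folklore] -/
theorem fromBlocks_diag_eq_add {ν m : ℕ} (z : Fin ν × Fin ν → ℂ) (y : Fin m × Fin m → ℂ) :
    (fun pq : Fin (ν + m) × Fin (ν + m) =>
      Matrix.fromBlocks (Matrix.of fun i j => z (i, j)) 0 0 (Matrix.of fun i j => y (i, j))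
        (finSumFinEquiv.symm pq.1) (finSumFinEquiv.symm pq.2)) =
    (fun pq => Matrix.fromBlocks (Matrix.of fun i j => z (i, j)) 0 0 (0 : Matrix (Fin m) (Fin m) ℂ)
        (finSumFinEquiv.symm pq.1) (finSumFinEquiv.symm pq.2)) +
      fun pq => Matrix.fromBlocks (0 : Matrix (Fin ν) (Fin ν) ℂ) 0 0 (Matrix.of fun i j => y (i, j))
        (finSumFinEquiv.symm pq.1) (finSumFinEquiv.symm pq.2) := by
  funext pq
  simp only [Pi.add_apply]
  rw [← Matrix.add_apply, Matrix.fromBlocks_add, add_zero, add_zero, zero_add, zero_add]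

/-- The zero-extended first block is supported on `inl × inl`. [folklore] -/
theorem fromBlocks_inl_ne_zero {ν m : ℕ} (z : Fin ν × Fin ν → ℂ) (p q : Fin (ν + m))
    (hne : Matrix.fromBlocks (Matrix.of fun i j => z (i, j)) 0 0 (0 : Matrix (Fin m) (Fin m) ℂ)
      (finSumFinEquiv.symm p) (finSumFinEquiv.symm q) ≠ 0) :
    (∃ i, finSumFinEquiv (Sum.inl i) = p) ∧ ∃ j, finSumFinEquiv (Sum.inl j) = q := by
  rcases hp : finSumFinEquiv.symm p with i | i <;> rcases hq : finSumFinEquiv.symm q with j | j <;>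
    simp [hp, hq] at hne
  exact ⟨⟨i, by rw [← hp, Equiv.apply_symm_apply]⟩, j, by rw [← hq, Equiv.apply_symm_apply]⟩

/-- The zero-extended second block is supported on `inr × inr`. [folklore] -/
theorem fromBlocks_inr_ne_zero {ν m : ℕ} (y : Fin m × Fin m → ℂ) (p q : Fin (ν + m))
    (hne : Matrix.fromBlocks (0 : Matrix (Fin ν) (Fin ν) ℂ) 0 0 (Matrix.of fun i j => y (i, j))
      (finSumFinEquiv.symm p) (finSumFinEquiv.symm q) ≠ 0) :
    (∃ i, finSumFinEquiv (Sum.inr i) = p) ∧ ∃ j, finSumFinEquiv (Sum.inr j) = q := by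
  rcases hp : finSumFinEquiv.symm p with i | i <;> rcases hq : finSumFinEquiv.symm q with j | j <;>
    simp [hp, hq] at hne
  exact ⟨⟨i, by rw [← hp, Equiv.apply_symm_apply]⟩, j, by rw [← hq, Equiv.apply_symm_apply]⟩

/-- The zero-extended first block reads `z` on `inl × inl`. [folklore] -/
theorem fromBlocks_inl_read {ν m : ℕ} (z : Fin ν × Fin ν → ℂ) (i j : Fin ν) :
    Matrix.fromBlocks (Matrix.of fun i j => z (i, j)) 0 0 (0 : Matrix (Fin m) (Fin m) ℂ)
      (finSumFinEquiv.symm (finSumFinEquiv (Sum.inl i) : Fin (ν + m)))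
      (finSumFinEquiv.symm (finSumFinEquiv (Sum.inl j) : Fin (ν + m))) = z (i, j) := by
  simp

/-- The zero-extended second block reads `y` on `inr × inr`. [folklore] -/
theorem fromBlocks_inr_read {ν m : ℕ} (y : Fin m × Fin m → ℂ) (i j : Fin m) :
    Matrix.fromBlocks (0 : Matrix (Fin ν) (Fin ν) ℂ) 0 0 (Matrix.of fun i j => y (i, j))
      (finSumFinEquiv.symm (finSumFinEquiv (Sum.inr i) : Fin (ν + m)))
      (finSumFinEquiv.symm (finSumFinEquiv (Sum.inr j) : Fin (ν + m))) = y (i, j) := by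
  simp

/-! ### Additivity on direct sums -/

/-- **CONNECTED PATTERNS ARE ADDITIVE ON WEIGHTED DIRECT SUMS.**  For a bipartite pattern `F` without isolated vertices
whose pattern graph is connected, and all `z ∈ ℂ^{ν×ν}`, `y ∈ ℂ^{m×m}`:
`hom_{F,ν+m}(z ⊕ y) = hom_{F,ν}(z) + hom_{F,m}(y)`, the block-diagonal point being `Matrix.fromBlocks z 0 0 y` read
through `finSumFinEquiv`. [cite: Lovasz2012, eq. (5.28); DawarPagoSeppelt2025, §7.1.1] -/
theorem eval_homPoly_directSum_of_connected {ν m a b : ℕ} (F : Multiset (Fin a × Fin b))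
    (hconn : (patternGraph F).Connected) (hrow : ∀ u, ∃ x ∈ F, x.1 = u) (hcol : ∀ v, ∃ x ∈ F, x.2 = v)
    (z : Fin ν × Fin ν → ℂ) (y : Fin m × Fin m → ℂ) :
    eval (fun pq : Fin (ν + m) × Fin (ν + m) =>
        Matrix.fromBlocks (Matrix.of fun i j => z (i, j)) 0 0 (Matrix.of fun i j => y (i, j))
          (finSumFinEquiv.symm pq.1) (finSumFinEquiv.symm pq.2)) (homPoly F (ν + m) ℂ) =
      eval z (homPoly F ν ℂ) + eval y (homPoly F m ℂ) := by
  -- `F` is nonempty: the pattern graph has a vertex, which is covered by an edge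
  have hF : F ≠ 0 := by
    obtain ⟨v⟩ := hconn.nonempty
    rcases v with i | j
    · obtain ⟨x, hx, -⟩ := hrow i
      exact fun h0 => by simp [h0] at hx
    · obtain ⟨x, hx, -⟩ := hcol j
      exact fun h0 => by simp [h0] at hx
  let κ : Fin (ν + m) → Bool := fun p => (finSumFinEquiv.symm p).isRight
  have hκZ : ∀ p q : Fin (ν + m),
      Matrix.fromBlocks (Matrix.of fun i j => z (i, j)) 0 0 (0 : Matrix (Fin m) (Fin m) ℂ)
          (finSumFinEquiv.symm p) (finSumFinEquiv.symm q) ≠ 0 → κ p = false ∧ κ q = false := by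
    intro p q hne
    obtain ⟨⟨i, rfl⟩, j, rfl⟩ := fromBlocks_inl_ne_zero z p q hne
    simp [κ]
  have hκY : ∀ p q : Fin (ν + m),
      Matrix.fromBlocks (0 : Matrix (Fin ν) (Fin ν) ℂ) 0 0 (Matrix.of fun i j => y (i, j))
          (finSumFinEquiv.symm p) (finSumFinEquiv.symm q) ≠ 0 → κ p = true ∧ κ q = true := by
    intro p q hne
    obtain ⟨⟨i, rfl⟩, j, rfl⟩ := fromBlocks_inr_ne_zero y p q hne
    simp [κ]
  rw [fromBlocks_diag_eq_add z y,
    eval_homPoly_add_of_preconnected κ (fun p q => hκZ p q) (fun p q => hκY p q) F hconn.preconnected hF]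
  have hιl : Function.Injective fun i : Fin ν => (finSumFinEquiv (Sum.inl i) : Fin (ν + m)) :=
    fun i j hij => by simpa using hij
  have hιr : Function.Injective fun i : Fin m => (finSumFinEquiv (Sum.inr i) : Fin (ν + m)) :=
    fun i j hij => by simpa using hij
  rw [eval_homPoly_zeroExtend (fun i : Fin ν => (finSumFinEquiv (Sum.inl i) : Fin (ν + m))) hιl
      (W := fun pq : Fin (ν + m) × Fin (ν + m) =>
        Matrix.fromBlocks (Matrix.of fun i j => z (i, j)) 0 0 (0 : Matrix (Fin m) (Fin m) ℂ)
          (finSumFinEquiv.symm pq.1) (finSumFinEquiv.symm pq.2))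
      (fun i j => fromBlocks_inl_read z i j) (fun p q => fromBlocks_inl_ne_zero z p q) F hrow hcol,
    eval_homPoly_zeroExtend (fun i : Fin m => (finSumFinEquiv (Sum.inr i) : Fin (ν + m))) hιr
      (W := fun pq : Fin (ν + m) × Fin (ν + m) =>
        Matrix.fromBlocks (0 : Matrix (Fin ν) (Fin ν) ℂ) 0 0 (Matrix.of fun i j => y (i, j))
          (finSumFinEquiv.symm pq.1) (finSumFinEquiv.symm pq.2))
      (fun i j => fromBlocks_inr_read y i j) (fun p q => fromBlocks_inr_ne_zero y p q) F hrow hcol]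

/-! ### The two-sided direct-sum congruence (appended) -/

/-- **Direct-sum congruence in the SECOND block**: `HomIndist m k y y' → HomIndist (ν + m) k (z ⊕ y) (z ⊕ y')` for
every weighted `z ∈ ℂ^{ν×ν}` (the one-level form `DirectSumCongruence.homIndist_add_of_blockSeparated` with the two
blocks exchanged: colour the indices by `isLeft`, zero-extend `y, y'` along `inr`). [cite: DawarPagoSeppelt2025, §7.1.1] -/
theorem homIndist_directSum_right {ν m k : ℕ} (z : Fin ν × Fin ν → ℂ) {y y' : Fin m × Fin m → ℂ}
    (hy : HomIndist m k y y') :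
    HomIndist (ν + m) k
      (fun pq => Matrix.fromBlocks (Matrix.of fun i j => z (i, j)) 0 0 (Matrix.of fun i j => y (i, j))
        (finSumFinEquiv.symm pq.1) (finSumFinEquiv.symm pq.2))
      (fun pq => Matrix.fromBlocks (Matrix.of fun i j => z (i, j)) 0 0 (Matrix.of fun i j => y' (i, j))
        (finSumFinEquiv.symm pq.1) (finSumFinEquiv.symm pq.2)) := by
  rw [fromBlocks_diag_eq_add z y, fromBlocks_diag_eq_add z y']
  set Zf : Fin (ν + m) × Fin (ν + m) → ℂ := fun pq =>
    Matrix.fromBlocks (Matrix.of fun i j => z (i, j)) 0 0 (0 : Matrix (Fin m) (Fin m) ℂ)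
      (finSumFinEquiv.symm pq.1) (finSumFinEquiv.symm pq.2) with hZf
  set Yf : Fin (ν + m) × Fin (ν + m) → ℂ := fun pq =>
    Matrix.fromBlocks (0 : Matrix (Fin ν) (Fin ν) ℂ) 0 0 (Matrix.of fun i j => y (i, j))
      (finSumFinEquiv.symm pq.1) (finSumFinEquiv.symm pq.2) with hYf
  set Y'f : Fin (ν + m) × Fin (ν + m) → ℂ := fun pq =>
    Matrix.fromBlocks (0 : Matrix (Fin ν) (Fin ν) ℂ) 0 0 (Matrix.of fun i j => y' (i, j))
      (finSumFinEquiv.symm pq.1) (finSumFinEquiv.symm pq.2) with hY'f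
  let κ : Fin (ν + m) → Bool := fun p => (finSumFinEquiv.symm p).isLeft
  have hκY : ∀ (x : Fin m × Fin m → ℂ) (p q : Fin (ν + m)),
      Matrix.fromBlocks (0 : Matrix (Fin ν) (Fin ν) ℂ) 0 0 (Matrix.of fun i j => x (i, j))
          (finSumFinEquiv.symm p) (finSumFinEquiv.symm q) ≠ 0 → κ p = false ∧ κ q = false := by
    intro x p q hne
    obtain ⟨⟨i, rfl⟩, j, rfl⟩ := fromBlocks_inr_ne_zero x p q hne
    simp [κ]
  have hκZ : ∀ p q : Fin (ν + m), Zf (p, q) ≠ 0 → κ p = true ∧ κ q = true := by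
    intro p q hne
    obtain ⟨⟨i, rfl⟩, j, rfl⟩ := fromBlocks_inl_ne_zero z p q hne
    simp [κ]
  have hιr : Function.Injective fun i : Fin m => (finSumFinEquiv (Sum.inr i) : Fin (ν + m)) :=
    fun i j hij => by simpa using hij
  have hYY' : HomIndist (ν + m) k Yf Y'f :=
    homIndist_zeroExtend (fun i : Fin m => (finSumFinEquiv (Sum.inr i) : Fin (ν + m))) hιr
      (fun i j => fromBlocks_inr_read y i j) (fun p q => fromBlocks_inr_ne_zero y p q)
      (fun i j => fromBlocks_inr_read y' i j) (fun p q => fromBlocks_inr_ne_zero y' p q) hy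
  have key := homIndist_add_of_blockSeparated κ (u := Yf) (u' := Y'f) (v := Zf)
    (fun p q => hκY y p q) (fun p q => hκY y' p q) hκZ hYY'
  rwa [add_comm Yf Zf, add_comm Y'f Zf] at key

/-- **THE TWO-SIDED DIRECT-SUM CONGRUENCE FOR WEIGHTED `HomIndist`**: `HomIndist ν k z z'` and `HomIndist m k y y'`
imply `HomIndist (ν + m) k (z ⊕ y) (z' ⊕ y')` — weighted disjoint union is a congruence in both arguments
(`DirectSumCongruence.homIndist_directSum` in the first block, `homIndist_directSum_right` in the second).
[cite: DawarPagoSeppelt2025, §7.1.1] -/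
theorem homIndist_directSum₂ {ν m k : ℕ} {z z' : Fin ν × Fin ν → ℂ} {y y' : Fin m × Fin m → ℂ}
    (hz : HomIndist ν k z z') (hy : HomIndist m k y y') :
    HomIndist (ν + m) k
      (fun pq => Matrix.fromBlocks (Matrix.of fun i j => z (i, j)) 0 0 (Matrix.of fun i j => y (i, j))
        (finSumFinEquiv.symm pq.1) (finSumFinEquiv.symm pq.2))
      (fun pq => Matrix.fromBlocks (Matrix.of fun i j => z' (i, j)) 0 0 (Matrix.of fun i j => y' (i, j))
        (finSumFinEquiv.symm pq.1) (finSumFinEquiv.symm pq.2)) :=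
  fun a b E htw => (homIndist_directSum hz y a b E htw).trans (homIndist_directSum_right z' hy a b E htw)

end Summit.ValiantsHypothesis.ValiantsHypothesis.Theorems.DirectSumAdditive

end
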